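import Summits.PneNP.PneNP.Theses.OneSlice
import Literature.Computability.Complexity.SwitchingLemma
import Literature.Computability.Complexity.CircuitInputMap

set_option linter.dupNamespace false

/-!
# Line `urn-harmonic-profile` for crux `SliceACZero` (stmt-PneNP-2835, route `OneSlice`) — planner skeleton v1

Crux (by name: `Summit.PneNP.PneNP.Theses.OneSlice.SliceACZero`, `Hyp → Conc`): IF for all `d c` there are
`k ≥ 3`, `δ > 0` with, eventually in `n`, every `{¬,∧,∨}`-circuit of `acDepth ≤ d` that errs w.p. `≤ δ` against
`k`-CLIQUE on `G(n,q)`, `q` in the critical window, has `> n^c` gates, THEN the same holds on every central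
slice `G(n,j)`.

The line (idea card `Ideas/urn-harmonic-profile.md`, triage r1-1/2/3: pass ×3) proves the TRANSFER statement
`SliceIndist` — a small constant-depth circuit cannot tell the Hamming slice `ν_j` from the product measure
`μ_{j/N}` on `{0,1}^N`, uniformly for `N^{1/4} ≤ j ≤ N/4` — from three circuit-free facts and one switching input:

* (U) `UrnLemma` — a depth-`s` decision tree cannot tell `i` balls drawn WITHOUT replacement from `M` from a
  coin of bias `i/M`: `|E_{ν_i} T − E_{μ_{i/M}} T| ≤ s²/M` (Diaconis–Freedman / birthday coupling; the queried
  coordinates are exchangeable under both laws, so adaptivity is free).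
* (R) `BiasSplitSwitching` — under the BIAS-SPLITTING restriction law `ℛ_{q,τ}` (each variable independently:
  `1` w.p. `q − τ/2`, free w.p. `τ`, `0` otherwise; freeing the stars with UNBIASED bits returns `μ_q`), a depth-`d`
  size-`N^c` circuit collapses to a decision tree of depth `O(log N)` except w.p. `N⁻²`, for every
  `τ ≤ q/polylog N`.  It is derived (`stub_biasSplit`) from the UNBIASED depth reduction `ACDepthReduction`
  (Håstad's switching lemma iterated, in probability form: the tree has the single-round `multiSwitching` and the
  deterministic round glue `HastadParity.inv_step`) by composing laws: round 1 = thinning + star-unbiasing (no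
  switching needed, triage r1-3 (a)), then `R_p` on the stars (`Circuit.exists_restrict` keeps basis/size/depth).
* (P) `SliceProfile` (`stub_profile : UrnLemma → BiasSplitSwitching → SliceProfile`) — the slice profile
  `a_i(C) = E_{ν_i}[C]` is SELF-AVERAGING: `a_i = Σ_l κ_{N,θ,i}(l) a_l ± η`, `η = K (log N)^B/√(θ i) + K/N`, where
  `κ_{N,θ,i} = law(i + Bin(N−i, θi/(4(N−i))) − Bin(i, θ/4))` (zero drift, variance `≈ θ i/2`) is the edge-count law
  after freeing-and-refilling the stars.  Mechanism: sample `x ∼ ν_i` and the restriction coins jointly; the bad event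
  is a function of the restriction, so `P_{ν_i}[bad] ≤ P_{μ_q}[bad]/P_{μ_q}[|x| = i] ≤ (N+1)·N⁻²` (`q = i/N`); given the
  restriction, the stars of `x` are UNIFORM ON A SUB-SLICE (slice law) resp. i.i.d. unbiased (`μ_q`), so (U) + bias
  continuity of depth-`s` trees give the defect; `S_N`-equivariance of the resampling makes the refilled input a
  `κ`-mixture of slices.
* (H) `SelfAveragingFlat` — a `[0,1]`-valued sequence that is `η`-self-averaging for the kernels `κ_{N,θ,i}` on
  the window `[j/2, 3j/2]` is within `ε + Kη/θ` of its `Bin(N, j/N)`-average (run the zero-drift walk with step law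
  `κ` for `T ≈ 2(1 − j/N)/θ` steps: each step costs `η`, and `law(X_T)` is `o(1)`-close in total variation to
  `Bin(N, j/N)` by a local CLT; regime `θ ≤ θ₀(ε)`, `θ⁶ j ≥ K(ε)`).
* `stub_indist : SliceProfile → SelfAveragingFlat → SliceIndist` (choose `θ = (log N)^{-B}`; `μ_q = Σ_l Bin·ν_l`),
  and the transfer `stub_reduction : SliceIndist → SliceACZero` (apply `SliceIndist` to `C ⊕ CLIQUE_k`-DNF on the
  edge set `≃ Fin C(n,2)`, then `Hyp` at the matched density `q = j/C(n,2)`, whose window clause is literally the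
  centrality clause of `Conc`; `δ := δ_Hyp/2`).

`SliceACZero_of` concludes the route decl BY NAME as a closed term over the seven registered stubs.

Disproof.lean (cdisprove v1/v2, read 2026-08-16) honoured: `not_innerConcNoWindow` / `…WindowAbove` — centrality is
used twice, in `stub_reduction` (q = j/N must sit in Hyp's window; `j ≥ m_k/2 ≥ n/8` gives `N ≤ j⁴`, `4j ≤ N`) and as
the rate `polylog/√j`; `not_innerConcNoBasis` — (R) is for `acBasis` only (a single CLIQUE gate is not a shallow tree
under any restriction leaving `θ j` stars); `not_innerConcNoError` — the error hypothesis is the input of the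
reduction; Part II (`lt_of_innerHyp`: `c < k`) — `k, δ` are taken from `Hyp(d,c)` unchanged; Parts IV/V constrain
`δ`/the window of `Conc` and are inherited from `Hyp` verbatim.  No `Theorems/SliceACZero/Negative/` module has
landed yet (nothing to import); `ledger negatives --problem PneNP` (5 entries) unrelated.
-/

noncomputable section

open scoped BigOperators Classical

namespace Summit.PneNP.PneNP.Cruxes.SliceACZero.UrnHarmonicProfile

open Finset Filter
open Literature.Computability.Complexity
open Summit.PneNP.PneNP.Theses.OneSlice (SliceACZero)

/-! ## Vocabulary (transparent definitions; everything lives on the cube `Fin M → Bool`) -/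

/-- Hamming weight `|y|` of a point of the cube `{0,1}^M`. -/
def weight {M : ℕ} (y : Fin M → Bool) : ℕ := #(univ.filter fun i => y i = true)

/-- `E_{ν_i}[g]`: the average of the Boolean test `g` over the Hamming slice `{y : |y| = i}` of `{0,1}^M`
(uniform measure `ν_i`; the slice has `C(M,i)` points; value `0` if `i > M`). -/
def sliceAvg (M i : ℕ) (g : (Fin M → Bool) → Bool) : ℝ :=
  (#(univ.filter fun y : Fin M → Bool => weight y = i ∧ g y = true) : ℝ) / (M.choose i : ℝ)

/-- `E_{μ_p}[g]`: the expectation of `g` under the `p`-biased product measure on `{0,1}^M`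
(`μ_p(y) = p^{|y|} (1-p)^{M-|y|}`; for `M = C(n,2)` this is `gnpWeight`). -/
def biasedAvg (M : ℕ) (p : ℝ) (g : (Fin M → Bool) → Bool) : ℝ :=
  ∑ y : Fin M → Bool, if g y = true then p ^ weight y * (1 - p) ^ (M - weight y) else 0

/-- `P[Bin(n, p) = k]` (as a real number; `0` for `k > n`). -/
def binPmf (n : ℕ) (p : ℝ) (k : ℕ) : ℝ := (n.choose k : ℝ) * p ^ k * (1 - p) ^ (n - k)

/-- The RESAMPLING KERNEL of the line at design density `i/N` and star fraction `θ`: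
`κ_{N,θ,i}(l) = P[i + X − Y = l]` with `X ∼ Bin(N − i, θ i/(4(N − i)))`, `Y ∼ Bin(i, θ/4)` independent — the law of
the Hamming weight after the stars of the bias-split restriction `ℛ_{i/N, θ i/N}` are freed and refilled with unbiased
bits, starting from the slice `i` (an `x`-one is starred w.p. `θ/2` and refilled `0` w.p. `1/2`; an `x`-zero is starred
w.p. `θ i/(2(N−i))` and refilled `1` w.p. `1/2`).  ZERO DRIFT: both binomial means are `θ i/4`; variance `≈ θ i/2`;
supported in `[0, N]`. -/
def kernel (N i : ℕ) (θ : ℝ) (l : ℕ) : ℝ :=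
  ∑ a ∈ range (N - i + 1), ∑ b ∈ range (i + 1),
    if i + a = l + b then binPmf (N - i) (θ * i / (4 * ((N : ℝ) - i))) a * binPmf i (θ / 4) b else 0

/-- `ρ` is BAD for `f` at depth `s`: the restricted function `u ↦ f (ρ.apply u)` (fixed variables of the partial
assignment `ρ : PAssign N` of `SwitchingLemma.lean` hard-wired, the others read from `u`) is computed by NO decision
tree (`DecisionTree N` of `DecisionTree.lean`) of depth `≤ s`. -/
def TreeBad (N s : ℕ) (f : (Fin N → Bool) → Bool) (ρ : PAssign N) : Prop :=
  ¬ ∃ T : DecisionTree N, T.depth ≤ s ∧ ∀ u : Fin N → Bool, T.eval u = f (ρ.apply u)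

/-- Weight of `ρ` under the BIAS-SPLITTING restriction law `ℛ_{q,τ}` on `PAssign N`: independently for each variable,
fixed to `1` w.p. `q − τ/2`, fixed to `0` w.p. `1 − q − τ/2`, left free w.p. `τ` (the junk value of a free variable is
weighted uniformly, `τ/2` each, exactly as in `rrWeight`).  Admissible for `0 ≤ τ ≤ 2q`, `q + τ/2 ≤ 1`; total mass `1`.
Freeing the stars with UNBIASED bits gives back the `q`-biased product measure (`(q − τ/2) + τ/2 = q`). -/
def bsWeight (N : ℕ) (q τ : ℝ) (ρ : PAssign N) : ℝ :=
  (∏ e ∈ ρ.dom, if ρ.val e = true then q - τ / 2 else 1 - q - τ / 2) * (τ / 2) ^ (N - ρ.dom.card)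

/-! ## The statements of the line (named `Prop`s; the stubs below assert them or implications between them) -/

/-- **(U) Urn lemma** (Diaconis–Freedman finite de Finetti, adaptive form).  A decision tree of depth `≤ s` on
`{0,1}^M` has almost the same acceptance probability under the uniform measure on the slice `|y| = i` and under the
product measure of bias `i/M`: `|E_{ν_i} T − E_{μ_{i/M}} T| ≤ s²/M` (the birthday coupling gives `s(s−1)/(2M)`;
brute-force checked by the ideator and by triage r1-1 C5 / r1-2 T3 / r1-3 C5).  Real division throughout
(triage r1-3 (b)).  Repeated queries of one coordinate are allowed by the type and harmless (deterministic under both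
laws).  [size M; provable now by induction on the tree carrying the numbers of queried coordinates and of ones seen] -/
def UrnLemma : Prop :=
  ∀ (M s i : ℕ) (T : DecisionTree M), 0 < M → i ≤ M → T.depth ≤ s →
    |sliceAvg M i (fun y => T.eval y) - biasedAvg M ((i : ℝ) / M) (fun y => T.eval y)| ≤ (s : ℝ) ^ 2 / M

/-- **(R₀) Depth reduction for `AC⁰` under the unbiased random restriction** (Håstad 1986 switching lemma iterated
over the `d` levels; Beame's primer §3; LMN 1993 Lemma; Tal 2017 §3), in PROBABILITY form with the tree's law
`rrWeight p` (`R_p`: each variable free w.p. `p`, else fixed to a uniform bit): for every depth `d` and size exponent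
`c` there is `B` such that for all large `N`, every `p ≤ (log N)^{-B}` and every circuit over `acBasis` with
`acDepth ≤ d` and `≤ N^c` gates, the `R_p`-mass of the restrictions under which the circuit is NOT a decision tree of
depth `≤ B·⌊log₂ N⌋` is at most `N^{-2}`.  (Round 1 = bottom fan-in: a bottom gate stays alive with `≥ s` free inputs
w.p. `≤ (C p s)^s` whatever its fan-in; rounds `2…d` = `multiSwitching` with `t = s`, `p_r = 1/(264(s+1))`, glued by
`inv_step`/`exists_decisionTree_of_cdt_le`; smaller `p` = one more restriction of the final tree,
`DecisionTree.depth_restrict_le`; the `d` round laws compose to `R_{p₁⋯p_d}` coordinatewise.)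
[size L; classical theorem, all combinatorial ingredients in `SwitchingLemma.lean` / `CircuitLowerBoundsHastadProofs.lean`] -/
def ACDepthReduction : Prop :=
  ∀ d c : ℕ, ∃ B : ℕ, ∀ᶠ N : ℕ in atTop, ∀ p : ℝ, 0 < p → p ≤ 1 / Real.log N ^ B →
    ∀ C : Circuit (Fin N), C.IsOver acBasis → C.acDepth ≤ d → C.size ≤ N ^ c →
      ∑ ρ ∈ univ.filter (fun ρ => TreeBad N (B * Nat.log 2 N) C.eval ρ), rrWeight p ρ ≤ 1 / (N : ℝ) ^ 2

/-- **(R) Bias-split switching**: the same depth reduction under the bias-splitting law `ℛ_{q,τ}` (`bsWeight`), for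
every design density `q ≤ 1/2` and every star probability `0 < τ ≤ q/(log N)^B` (stars `τN = qN/polylog = j/polylog`
when `q = j/N`).  This is the idea's round structure: round 1 at the biased law only thins and UNBIASES the stars
(Beame's imbalanced lemma is not needed: star ratio `τ/q ≤ 1/polylog`), the remaining rounds are Håstad's unbiased
ones.  [size M given (R₀): `stub_biasSplit`] -/
def BiasSplitSwitching : Prop :=
  ∀ d c : ℕ, ∃ B : ℕ, ∀ᶠ N : ℕ in atTop, ∀ q τ : ℝ, 0 < τ → τ ≤ q / Real.log N ^ B → q ≤ 1 / 2 →
    ∀ C : Circuit (Fin N), C.IsOver acBasis → C.acDepth ≤ d → C.size ≤ N ^ c →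
      ∑ ρ ∈ univ.filter (fun ρ => TreeBad N (B * Nat.log 2 N) C.eval ρ), bsWeight N q τ ρ ≤ 1 / (N : ℝ) ^ 2

/-- **(R₀) ⇒ (R)**: write `ℛ_{q,τ}` as the composition of the round-1 law `ℛ_{q,σ}`, `σ = τ (log N)^{B}` (`≤ q`), with an
independent `R_p`, `p = (log N)^{-B}`, on all variables (a variable free after both rounds: w.p. `σp = τ`; fixed to `1`:
`(q − σ/2) + σ(1−p)/2 = q − τ/2`); for each round-1 outcome `ρ₁` apply (R₀) (at depth `max d 1`) to the hard-wired
circuit `C↾ρ₁` (`Circuit.exists_restrict`: over `acBasis`, size `≤ max |C| 1`, `acDepth ≤ max d 1`), whose bad event at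
`ρ'` is the bad event of `C` at the composite restriction; sum `bsWeight q σ` (total mass 1) over `ρ₁`.
[size M: the coordinatewise pushforward identity for composed restriction laws + `exists_restrict`] -/
def BiasSplitOfDepthReduction : Prop := ACDepthReduction → BiasSplitSwitching

/-- **(H) Self-averaging ⇒ flat at the binomial scale** (pure probability; no circuits).  For every `ε > 0` there are
`θ₀ > 0` and `K` such that for `0 < θ ≤ θ₀`, `K ≤ θ⁶ j`, `4j ≤ N ≤ j⁴` (the regime of the application; the
statement should hold without the upper bound on `N`): if `a : ℕ → [0,1]` satisfies
`|a_i − Σ_l κ_{N,θ,i}(l) a_l| ≤ η` for all `i ∈ [j/2, 3j/2]`, then `|a_j − Σ_l P[Bin(N, j/N) = l]·a_l| ≤ ε + K η/θ`.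
Proof idea: the Markov chain `X₀ = j`, `X_{t+1} ∼ κ_{N,θ,X_t}` is a martingale with conditional variance `≈ θ X_t/2`;
stop it at `T = ⌈2(1 − j/N)/θ⌉ ≤ 3/θ` steps or on leaving the window (Doob: w.p. `≤ 8/j`): `E a(X_T) = a_j ± (Tη + o(1))`,
and `law(X_T)` is within `O(θ) + O(θ^{-3/2} j^{-1/2})` of `Bin(N, j/N)` in total variation (one-step local CLT for sums of
independent Bernoullis with variance `θ j/2 → ∞`, accumulated over `T` steps; variance matching up to the rounding of
`T`).  Sharp: quadratic profiles `a_l = ((l−j)/√j)²/100` have defect `η = θ/200` and deviation `≈ 1/100 ≈ Tη`.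
[size L — HARDEST: a local CLT in total variation for an inhomogeneous zero-drift walk, none of it in Mathlib] -/
def SelfAveragingFlat : Prop :=
  ∀ ε : ℝ, 0 < ε → ∃ θ₀ : ℝ, 0 < θ₀ ∧ ∃ K : ℝ, 0 < K ∧ ∀ θ : ℝ, 0 < θ → θ ≤ θ₀ →
    ∀ N j : ℕ, N ≤ j ^ 4 → K ≤ θ ^ 6 * j → 4 * j ≤ N →
    ∀ a : ℕ → ℝ, (∀ l, 0 ≤ a l ∧ a l ≤ 1) → ∀ η : ℝ, 0 ≤ η →
      (∀ i : ℕ, j ≤ 2 * i → 2 * i ≤ 3 * j → |a i - ∑ l ∈ range (N + 1), kernel N i θ l * a l| ≤ η) →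
      |a j - ∑ l ∈ range (N + 1), binPmf N ((j : ℝ) / N) l * a l| ≤ ε + K * η / θ

/-- **(P) The slice profile of a small `AC⁰` test is self-averaging.**  For every `d c` there are `B`, `K` such that
for all large `N`, every star fraction `0 < θ ≤ (log N)^{-B}`, every slice `0 < i ≤ N/2` and every circuit over `acBasis`
of `acDepth ≤ d` and size `≤ N^c`: `|a_i(C) − Σ_l κ_{N,θ,i}(l) a_l(C)| ≤ K (log N)^B/√(θ i) + K/N`, where
`a_l(C) = E_{ν_l}[C]`.  (Two-stage sampling of `ν_i`: `x ∼ ν_i`, then the coins of `ℛ_{q,τ}`, `q = i/N`, `τ = θ q`,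
conditioned on `x` — an `x`-one is starred w.p. `θ/2`, an `x`-zero w.p. `θ i/(2(N − i))`; the restriction `ρ = x` off
the stars is a function of `(x, coins)`, so `P_{ν_i}[ρ bad] ≤ P_{μ_q}[ρ bad] / P_{μ_q}[|x| = i] ≤ (N+1) N^{-2}` by (R);
given `ρ` the stars of `x` are uniform on a sub-slice, so on good `ρ` the urn lemma (U) on the star set (`s²/|A|`,
`|A| ≈ θ i`) and bias continuity of depth-`s` trees (`s·|i'/|A| − 1/2| ≈ s/√(θ i)`) compare `E[C(x) | ρ]` with
`E[C(x̃) | ρ]`, `x̃ = ρ ⊔` unbiased stars; `x̃` is `S_N`-equivariant with `|x̃| ∼ κ_{N,θ,i}`, hence a `κ`-mixture of slices.)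
The bound is trivial when `θ i < 1` (`K ≥ 1`).  [size L given (U), (R): `stub_profile`] -/
def SliceProfile : Prop :=
  ∀ d c : ℕ, ∃ B : ℕ, ∃ K : ℝ, ∀ᶠ N : ℕ in atTop, ∀ θ : ℝ, 0 < θ → θ ≤ 1 / Real.log N ^ B →
    ∀ i : ℕ, 0 < i → 2 * i ≤ N →
    ∀ C : Circuit (Fin N), C.IsOver acBasis → C.acDepth ≤ d → C.size ≤ N ^ c →
      |sliceAvg N i C.eval - ∑ l ∈ range (N + 1), kernel N i θ l * sliceAvg N l C.eval|
        ≤ K * Real.log N ^ B / Real.sqrt (θ * i) + K / N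

/-- **(U), (R) ⇒ (P)** — the slice-transfer step of the line (see `SliceProfile`). -/
def ProfileOfUrnSwitching : Prop := UrnLemma → BiasSplitSwitching → SliceProfile

/-- **C⁺ — slice indistinguishability for `AC⁰`** (the transfer target; it deletes `Hyp`, CLIQUE, `k` and `δ` from the
crux): for all `d c` and `ε > 0`, for all large `N`, every `j` with `N ≤ j⁴` and `4j ≤ N`, and every circuit over
`acBasis` of `acDepth ≤ d` and size `≤ N^c`: `|E_{ν_j}[C] − E_{μ_{j/N}}[C]| ≤ ε` (true rate: `polylog(N)/√j`).
FALSE for `AC⁰[⊕]` (parity of `|y|` is constant on a slice) — the depth-reduction input is where `acBasis` is used. -/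
def SliceIndist : Prop :=
  ∀ d c : ℕ, ∀ ε : ℝ, 0 < ε → ∀ᶠ N : ℕ in atTop, ∀ j : ℕ, N ≤ j ^ 4 → 4 * j ≤ N →
    ∀ C : Circuit (Fin N), C.IsOver acBasis → C.acDepth ≤ d → C.size ≤ N ^ c →
      |sliceAvg N j C.eval - biasedAvg N ((j : ℝ) / N) C.eval| ≤ ε

/-- **(P), (H) ⇒ C⁺**: take `θ = (log N)^{-B}` (`≤ θ₀(ε/2)` eventually), `a_l = E_{ν_l}[C] ∈ [0,1]`, `η` = the bound of (P)
at `i = ⌈j/2⌉` (monotone in `i`); the regime `K ≤ θ⁶ j` holds because `j ≥ N^{1/4}`; `ε/2 + K η/θ ≤ ε` eventually since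
`η/θ = polylog(N)·(N^{-1/8} + N^{-1})`; finally `E_{μ_q}[C] = Σ_l P[Bin(N,q) = l]·E_{ν_l}[C]` (fibrewise summation,
`#{y : |y| = l} = C(N,l)`).  [size M: `stub_indist`] -/
def IndistOfProfileFlat : Prop := SliceProfile → SelfAveragingFlat → SliceIndist

/-- **Transfer C⁺ ⇒ crux.**  Given `Hyp`, `d`, `c`: take `(k, δ_H)` from `Hyp d c` and answer `Conc d c` with the same `k`
and `δ := δ_H/2`.  For large `n`, central `j`, `C` over `acBasis` with `acDepth ≤ d` and slice error `≤ δ·#slice_j`: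
if `n^c < |C|` we are done; otherwise the test `g = [C ≠ CLIQUE_k]` is computed by the circuit `C ⊕ D_k`, `D_k` the
exhaustive clique DNF (`exists_cliqueDNF_monotoneAC`: `acDepth ≤ 2`, `≤ C(n,k)+1` gates), i.e. `(C ∧ ¬D_k) ∨ (¬C ∧ D_k)`
of `acDepth ≤ max d 2 + 2` and `≤ n^c + C(n,k) + 6 ≤ N^{c+k+3}` gates, transported to `Fin N`, `N = C(n,2)`, along
`Fintype.equivFin` (`Circuit.mapInputs`: same gates, basis, `acDepth`; slice and `G(n,q)` weights are invariant under
the renaming); centrality gives `j ≥ m_k/2 ≥ n/8` and `j ≤ 2m_k ≤ 2N n^{-2/(k-1)}`, so `N ≤ j⁴` and `4j ≤ N` eventually;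
`SliceIndist (d+4) (c+k+3) (δ_H/2)`
yields `E_{μ_{j/N}}[g] ≤ E_{ν_j}[g] + δ_H/2 ≤ δ_H`, i.e. `gnpDisagreeProb n (j/N) C (cliqueFn n k) ≤ δ_H`, and `Hyp` at
`q = j/N ∈ [0,1]` — whose window clause `|qN − m_k| ≤ m_k^{3/4}` is the centrality clause since `qN = j` — gives
`n^c < |C|`.  Honours `Disproof.not_innerConcNoWindow/WindowAbove` (centrality used), `not_innerConcNoBasis`
(`acBasis` needed for C⁺), `lt_of_innerHyp` (`k` from `Hyp`).  [size M: `stub_reduction`] -/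
def Reduction : Prop := SliceIndist → SliceACZero

/-! ## Registered stubs (the only `sorry`s of the line) -/

/-- **stub_urn** — (U) `UrnLemma` [M, provable now]. -/
theorem stub_urn : UrnLemma := by
  sorry

/-- **stub_acDepthReduction** — (R₀) `ACDepthReduction` [L, classical; iterate the in-tree switching lemma in
probability form]. -/
theorem stub_acDepthReduction : ACDepthReduction := by
  sorry

/-- **stub_biasSplit** — (R₀) ⇒ (R) `BiasSplitOfDepthReduction` [M; law composition + `Circuit.exists_restrict`]. -/
theorem stub_biasSplit : BiasSplitOfDepthReduction := by
  sorry

/-- **stub_selfAveragingFlat** — (H) `SelfAveragingFlat` [L, HARDEST; local CLT in total variation]. -/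
theorem stub_selfAveragingFlat : SelfAveragingFlat := by
  sorry

/-- **stub_profile** — (U), (R) ⇒ (P) `ProfileOfUrnSwitching` [L; the two-stage sampling / sub-slice uniformity /
ratio-of-small-probabilities / `S_N`-equivariance bookkeeping, all finite sums]. -/
theorem stub_profile : ProfileOfUrnSwitching := by
  sorry

/-- **stub_indist** — (P), (H) ⇒ C⁺ `IndistOfProfileFlat` [M; parameter choice `θ = (log N)^{-B}` and the binomial
mixture identity]. -/
theorem stub_indist : IndistOfProfileFlat := by
  sorry

/-- **stub_reduction** — C⁺ ⇒ crux `Reduction` [M; XOR with the clique DNF, `edgeSet ≃ Fin C(n,2)`, `Hyp` at `q = j/N`]. -/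
theorem stub_reduction : Reduction := by
  sorry

/-! ## Composition -/

/-- **Skeleton theorem**: the crux `SliceACZero` BY NAME, as a closed term over the seven registered stubs:
`reduction (indist (profile urn (biasSplit acDepthReduction)) selfAveragingFlat)`. -/
theorem SliceACZero_of : SliceACZero :=
  stub_reduction
    (stub_indist (stub_profile stub_urn (stub_biasSplit stub_acDepthReduction)) stub_selfAveragingFlat)

end Summit.PneNP.PneNP.Cruxes.SliceACZero.UrnHarmonicProfile

end
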